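import Mathlib
import HarnessLib
import Literature.Computability.AlgebraicComplexity.PatternExpressions
import Literature.Computability.AlgebraicComplexity.EsymmWitnessDegree
import Literature.Computability.AlgebraicComplexity.QPBoundedClosure
import Summits.ValiantsHypothesis.ValiantsHypothesis.Theorems.MonotoneRestorationOrbitCompressionQPCoefficientSlices
import Summits.ValiantsHypothesis.ValiantsHypothesis.Theorems.MonotoneRestorationOrbitCompressionQPOneRowGadget
import Summits.ValiantsHypothesis.ValiantsHypothesis.Theorems.MonotoneRestorationOrbitCompressionQPMultiRowStratum

/-!
# Route MonotoneRestoration — aside `OrbitCompressionQP` (stmt-ValiantsHypothesis-18332), line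
# `expression_compression`: the PINNED-ENTRY ROW GADGET and the 2-row stratum for inner polynomials
# AFFINE IN THE SECOND ROW

The first open case of `stub_narrowExpressionCompression` after the one-row stratum is the 2-row stratum
`f_n = Σ_{i,i'} g_n(row i, row i')`, `g_n(r, s)` symmetric under simultaneous permutation of the columns —
open in general ("vector-symmetric Bläser–Jindal", not in print).  This file closes its first rung WITHOUT
new named facts: the inner polynomials that are AFFINE in the second row,

  `g_n(r, s) = Σ_b s_b · H_n(r_b ; r_0, …, r_{n-1})`, `H_n(t; r) ∈ ℂ[t, r]` a `VQP` family symmetric in `r`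

(every column-symmetric `g` affine in `s` is `g_0(r) +` such a term: `∂g/∂s_b = F(r_b; r_{-b})` with `F`
symmetric in the punctured row, and `F(r_b; r_{-b}) = H(r_b; r)` for the polynomial
`H(t; r) := F^{ps}(t; p_1(r) − t, p_2(r) − t², …)` — division-free; the one-row term `g_0` is
`…OneRowStratum`).  The mechanism is a ROW GADGET WITH A PINNED ENTRY:

* `exists_narrow_subst_of_isVQPFamily_general` — the `VQP` substitution principle of
  `…FormulaSubstitution` for arbitrary finite variable types (needed for the packaged family below);
* `exists_sliceCores` — symmetric cores of the `t`-slices of `H_n(t; r)` (`…CoefficientSlices`);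
* ★★ `exists_pinnedEntryRowGadget` — for a `VQP` family `H_n ∈ ℂ[t, r_0..r_{n-1}]` symmetric in `r` there are
  `(1,1)`-label pattern expressions `W_n` of quasi-polynomial length with
  `W_n.value ρ γ = H_n(x_{ρ0,γ0}; x_{ρ0,0}, …, x_{ρ0,n-1})` — the pinned entry substituted for `t`, the pinned
  row for `r`.  Proof: slice `H_n = Σ_d t^d H_{n,d}(r)` (root-of-unity interpolation keeps every slice in `VQP`,
  `complexity_coeffEps_le`), take Bläser–Jindal cores `P_{n,d}` of the symmetric slices (the tree's PROVED
  `BlaserJindal2019_thm4_holds`, applied pointwise), PACKAGE them as one `VQP` family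
  `Q_n = Σ_d w_d · P_{n,d}(y) ∈ ℂ[y ⊔ w]`, and substitute `y_j ↦ e_j(row ρ0)` (Newton substituends with the
  row label open) and `w_d ↦ x_{ρ0,γ0}^d`;
* ★ `narrowQP_twoRow_pinnedAffine` — the 2-ROW STRATUM FOR SECOND-ROW-AFFINE inner polynomials:
  `f_n = Σ_i Σ_b (Σ_{i'} x_{i'b}) · H_n(x_{ib}; row i) = Σ_{i,i'} g_n(row i, row i')` satisfies the conclusion of
  `stub_narrowExpressionCompression` with `(2,1)` labels; `narrowQP_twoRow_pinnedAffine_of_VP` the `VP` case.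

Helper file (`--supports stmt-ValiantsHypothesis-18332`); def-free; nothing here is a named fact (Bläser–Jindal
is the tree's proved `BlaserJindal2019_thm4_holds`); no registered stub is closed; VP ≠ VNP is not moved.
-/

noncomputable section

open MvPolynomial

-- `Summit.ValiantsHypothesis.ValiantsHypothesis.…` is the tree's single-conjunct layout (Sub = Summit).
set_option linter.dupNamespace false

namespace Summit.ValiantsHypothesis.ValiantsHypothesis.Theorems

namespace FormulaSubstitution

open Literature.Computability.AlgebraicComplexity

/-! ### The substitution principle for arbitrary finite variable types -/

/-- **`VQP` substitution principle, general variable types** (as `exists_narrow_subst_of_isVQPFamily`, whose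
variables are `Fin (m n)`): BCS (21.33) `VQP_e = VQP` + the substitution engine.
[cite: BurgisserClausenShokrollahi1997, Thm. (21.33)] -/
theorem exists_narrow_subst_of_isVQPFamily_general {ι : ℕ → Type} [∀ n, Fintype (ι n)]
    (Q : (n : ℕ) → MvPolynomial (ι n) ℂ) (hQ : IsVQPFamily Q) {k l : ℕ → ℕ}
    (θ : (n : ℕ) → ι n → PatternExpr ℂ (k n) (l n))
    (hθ : ∃ c : ℕ, ∀ n : ℕ, 1 ≤ n → ∀ i, (θ n i).length ≤ 2 ^ ((Nat.log 2 n + c) ^ c)) :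
    ∃ c : ℕ, ∀ n : ℕ, 1 ≤ n → ∃ e : PatternExpr ℂ (k n) (l n),
      e.length ≤ 2 ^ ((Nat.log 2 n + c) ^ c) ∧
      ∀ (ρ : Fin (k n) → Fin n) (γ : Fin (l n) → Fin n),
        e.value n ρ γ = aeval (fun i => (θ n i).value n ρ γ) (Q n) := by
  obtain ⟨a, ha⟩ := ((isVQPeFamily_iff_isVQPFamily ℂ ι Q).2 hQ).2
  obtain ⟨b, hb⟩ := hθ
  obtain ⟨c, hc⟩ := qp_subst_bound a b
  refine ⟨c, fun n hn => ?_⟩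
  obtain ⟨e, hl, hv⟩ := exists_subst_of_formulaComplexity_le (Q n) (ha n) (θ n) (hb n hn)
    Nat.one_le_two_pow
  exact ⟨e, hl.trans (hc _ _ _ le_rfl le_rfl), hv n⟩

/-! ### Slices and their symmetric cores -/

/-- **Symmetric cores of the slices.**  For `H ∈ ℂ[t, r_0, …, r_{n-1}]` symmetric in `r`, every `t`-slice
`coeffEps d H` is `P_d(e_1(r), …, e_n(r))` for some `P_d`. [folklore] -/
theorem exists_sliceCores {n : ℕ} (H : MvPolynomial (Option (Fin n)) ℂ)
    (hsymm : ∀ τ : Equiv.Perm (Fin n), rename (Option.map τ) H = H) :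
    ∃ P : ℕ → MvPolynomial (Fin n) ℂ, ∀ d : ℕ,
      aeval (fun j : Fin n => esymm (Fin n) ℂ (j.val + 1)) (P d) = coeffEps d H := by
  choose P hP using fun d : ℕ =>
    exists_symmetricCore (coeffEps d H) (CoefficientSlices.isSymmetric_coeffEps H hsymm d)
  exact ⟨P, hP⟩

/-- **The cores are cheap** (Bläser–Jindal, pointwise): with the tree's constant `c` of
`BlaserJindal2019_thm4_holds`, `L(P_d) ≤ ((D+1)(L(H)+2) + 1 + deg H + n + 2)^c` whenever `deg_t H ≤ D`,
`d ≤ D`. [cite: BlaserJindal2019, Thm. 4] -/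
theorem exists_complexity_sliceCore_le :
    ∃ c : ℕ, ∀ (n : ℕ) (H : MvPolynomial (Option (Fin n)) ℂ) (P : MvPolynomial (Fin n) ℂ) (D d : ℕ),
      H.degreeOf none ≤ D → d ≤ D →
      aeval (fun j : Fin n => esymm (Fin n) ℂ (j.val + 1)) P = coeffEps d H →
      complexity P ≤ ((D + 1) * (complexity H + 2) + 1 + H.totalDegree + n + 2) ^ c := by
  obtain ⟨c, hc⟩ := BlaserJindal2019_thm4_holds
  refine ⟨c, fun n H P D d hD hd hP => ?_⟩
  have h1 := hc n P
  rw [hP] at h1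
  refine h1.trans (Nat.pow_le_pow_left ?_ c)
  have h2 := CoefficientSlices.complexity_coeffEps_le H hD hd
  have h3 := CoefficientSlices.totalDegree_coeffEps_le H d
  omega

/-- **Degrees of the cores**: `deg P_d ≤ deg H`. [folklore] -/
theorem totalDegree_sliceCore_le {n : ℕ} (H : MvPolynomial (Option (Fin n)) ℂ) (P : MvPolynomial (Fin n) ℂ)
    (d : ℕ) (hP : aeval (fun j : Fin n => esymm (Fin n) ℂ (j.val + 1)) P = coeffEps d H) :
    P.totalDegree ≤ H.totalDegree := by
  refine (totalDegree_le_totalDegree_aeval_esymm P).trans ?_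
  rw [hP]
  exact CoefficientSlices.totalDegree_coeffEps_le H d

/-! ### The pinned-entry row gadget -/

/-- ★★ **Pinned-entry row gadget.**  For a `VQP` family `H_n ∈ ℂ[t, r_0, …, r_{n-1}]` (variables
`Option (Fin n)`, `none = t`) symmetric in `r`, there are `(1,1)`-label pattern expressions of
quasi-polynomial length whose value at `(ρ, γ)` is `H_n(x_{ρ0,γ0}; x_{ρ0,0}, …, x_{ρ0,n-1})`.
[cite: BlaserJindal2019, Thm. 4] -/
theorem exists_pinnedEntryRowGadget (H : (n : ℕ) → MvPolynomial (Option (Fin n)) ℂ)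
    (hsymm : ∀ (n : ℕ) (τ : Equiv.Perm (Fin n)), rename (Option.map τ) (H n) = H n)
    (hH : IsVQPFamily H) :
    ∃ c : ℕ, ∀ n : ℕ, 1 ≤ n → ∃ W : PatternExpr ℂ 1 1,
      W.length ≤ 2 ^ ((Nat.log 2 n + c) ^ c) ∧
      ∀ (ρ γ : Fin 1 → Fin n), W.value n ρ γ =
        aeval (fun o : Option (Fin n) => o.elim (X (ρ 0, γ 0))
          (fun j => (X (ρ 0, j) : MvPolynomial (Fin n × Fin n) ℂ))) (H n) := by
  classical
  -- degrees
  set D : ℕ → ℕ := fun n => (H n).totalDegree with hDdef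
  have hDt : ∀ n, (H n).degreeOf none ≤ D n := fun n => CoefficientSlices.degreeOf_none_le_totalDegree _
  have hDp : IsPBounded D := hH.1.2
  -- slices and cores
  choose P hP using fun n => exists_sliceCores (H n) (hsymm n)
  obtain ⟨cBJ, hBJ⟩ := exists_complexity_sliceCore_le
  have hPc : ∀ n d, d ≤ D n → complexity (P n d) ≤
      ((D n + 1) * (complexity (H n) + 2) + 1 + D n + n + 2) ^ cBJ :=
    fun n d hd => hBJ n (H n) (P n d) (D n) d (hDt n) hd (hP n d)
  have hPd : ∀ n d, (P n d).totalDegree ≤ D n := fun n d => totalDegree_sliceCore_le (H n) (P n d) d (hP n d)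
  -- the packaged family `Q_n = Σ_d w_d · P_{n,d}(y)`
  set Q : (n : ℕ) → MvPolynomial (Fin n ⊕ Fin (D n + 1)) ℂ := fun n =>
    ∑ d : Fin (D n + 1), X (Sum.inr d) * rename Sum.inl (P n d.val) with hQdef
  have hQ : IsVQPFamily Q := by
    refine ⟨⟨?_, ?_⟩, ?_⟩
    · -- number of variables
      have h : IsPBounded fun n => n + (D n + 1) :=
        IsPBounded.add_holds IsPBounded.id (IsPBounded.add_holds hDp (IsPBounded.const 1))
      refine h.mono fun n => ?_
      simp [Fintype.card_sum, Fintype.card_fin]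
    · -- degree
      have h : IsPBounded fun n => D n + 1 := IsPBounded.add_holds hDp (IsPBounded.const 1)
      refine h.mono fun n => ?_
      refine (totalDegree_finsetSum _ _).trans (Finset.sup_le fun d _ => ?_)
      calc (X (Sum.inr d) * rename Sum.inl (P n d.val) : MvPolynomial (Fin n ⊕ Fin (D n + 1)) ℂ).totalDegree
          ≤ (X (Sum.inr d) : MvPolynomial (Fin n ⊕ Fin (D n + 1)) ℂ).totalDegree +
              (rename Sum.inl (P n d.val) : MvPolynomial (Fin n ⊕ Fin (D n + 1)) ℂ).totalDegree :=
            totalDegree_mul _ _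
        _ ≤ 1 + D n := by
            refine Nat.add_le_add ?_ ((totalDegree_rename_le _ _).trans (hPd n d.val))
            rw [totalDegree_X]
        _ = D n + 1 := by omega
    · -- complexity
      have hDq : IsQPBounded D := hDp.isQPBounded
      have hD1 : IsQPBounded fun n => D n + 1 := hDq.add (IsQPBounded.const 1)
      have hL : IsQPBounded fun n => complexity (H n) := hH.2
      have hInner : IsQPBounded fun n => (D n + 1) * (complexity (H n) + 2) + 1 + D n + n + 2 :=
        ((((hD1.mul (hL.add (IsQPBounded.const 2))).add (IsQPBounded.const 1)).add hDq).add
          (IsPBounded.id.isQPBounded)).add (IsQPBounded.const 2)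
      have hβ : IsQPBounded fun n =>
          (D n + 1) * (((D n + 1) * (complexity (H n) + 2) + 1 + D n + n + 2) ^ cBJ + 2) :=
        hD1.mul ((hInner.pow cBJ).add (IsQPBounded.const 2))
      refine hβ.mono fun n => ?_
      have hsum := complexity_finset_sum_le (Finset.univ : Finset (Fin (D n + 1)))
        (fun d => (X (Sum.inr d) * rename Sum.inl (P n d.val) : MvPolynomial (Fin n ⊕ Fin (D n + 1)) ℂ))
      rw [Finset.card_univ, Fintype.card_fin] at hsum
      have hterm : ∀ d : Fin (D n + 1),
          complexity (X (Sum.inr d) * rename Sum.inl (P n d.val) : MvPolynomial (Fin n ⊕ Fin (D n + 1)) ℂ) ≤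
            ((D n + 1) * (complexity (H n) + 2) + 1 + D n + n + 2) ^ cBJ + 1 := by
        intro d
        refine (complexity_mul_le_holds _ _).trans ?_
        rw [complexity_X_holds]
        have h1 := complexity_rename_le_holds' (Sum.inl : Fin n → Fin n ⊕ Fin (D n + 1)) (P n d.val)
        have h2 := hPc n d.val (by have := d.isLt; omega)
        omega
      have hsum' : ∑ d : Fin (D n + 1),
          complexity (X (Sum.inr d) * rename Sum.inl (P n d.val) : MvPolynomial (Fin n ⊕ Fin (D n + 1)) ℂ) ≤
            (D n + 1) * (((D n + 1) * (complexity (H n) + 2) + 1 + D n + n + 2) ^ cBJ + 1) := by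
        calc _ ≤ ∑ _d : Fin (D n + 1), (((D n + 1) * (complexity (H n) + 2) + 1 + D n + n + 2) ^ cBJ + 1) :=
              Finset.sum_le_sum fun d _ => hterm d
          _ = _ := by rw [Finset.sum_const, Finset.card_univ, Fintype.card_fin, smul_eq_mul]
      show complexity (Q n) ≤ _
      calc complexity (Q n) ≤ _ := hsum
        _ ≤ (D n + 1) * (((D n + 1) * (complexity (H n) + 2) + 1 + D n + n + 2) ^ cBJ + 1) + (D n + 1) :=
            Nat.add_le_add_right hsum' _
        _ = (D n + 1) * (((D n + 1) * (complexity (H n) + 2) + 1 + D n + n + 2) ^ cBJ + 2) := by ring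
  -- substituends: Newton substituends for `y_j`, powers of the pinned entry for `w_d`
  choose E hE using fun n : ℕ => exists_rowEsymm n n
  choose Epw hEpwl hEpwv using fun d : ℕ => exists_edge_pow (F := ℂ) (k := 1) (l := 1) 0 0 d
  set θ : (n : ℕ) → Fin n ⊕ Fin (D n + 1) → PatternExpr ℂ 1 1 := fun n =>
    Sum.elim (fun j => E n (j.val + 1)) (fun d => Epw d.val) with hθdef
  have hθ : ∃ c : ℕ, ∀ n : ℕ, 1 ≤ n → ∀ i, (θ n i).length ≤ 2 ^ ((Nat.log 2 n + c) ^ c) := by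
    obtain ⟨c₁, hc₁⟩ := esymm_subst_length_qp 1
    obtain ⟨a, ha⟩ := hDp
    obtain ⟨c₂, hc₂⟩ := NarrowClosure.qp_combine (a + 1) 0
    refine ⟨max c₁ c₂, fun n hn i => ?_⟩
    rcases i with j | d
    · have h1 := (hE n (j.val + 1) (by have := j.isLt; omega)).1
      have h2 := hc₁ n n (by simp)
      calc (θ n (Sum.inl j)).length = (E n (j.val + 1)).length := rfl
        _ ≤ (2 * (n + 1) + 2) ^ (Nat.log 2 n + 1) * ((2 * n + 3) + 2 + (n + 1) + 1) :=
            h1.trans (Nat.mul_le_mul_left _ (by omega))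
        _ ≤ 2 ^ ((Nat.log 2 n + c₁) ^ c₁) := h2
        _ ≤ 2 ^ ((Nat.log 2 n + max c₁ c₂) ^ max c₁ c₂) :=
            Nat.pow_le_pow_right (by norm_num) (CompressionFloors.polylog_mono (le_max_left _ _))
    · have h1 : (Epw d.val).length = 2 * d.val + 1 := hEpwl d.val
      have hd : d.val ≤ D n := by have := d.isLt; omega
      have hX : n ^ a + a ≤ 2 ^ ((Nat.log 2 n + (a + 1)) ^ (a + 1)) := CompressionFloors.pbounded_le_qp n a
      have h3 := hc₂ (Nat.log 2 n) (n ^ a + a) 1 hX (by simp)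
      have h4 := ha n
      calc (θ n (Sum.inr d)).length = 2 * d.val + 1 := h1
        _ ≤ (n ^ a + a + 2) * (1 + 2) := by omega
        _ ≤ 2 ^ ((Nat.log 2 n + c₂) ^ c₂) := h3
        _ ≤ 2 ^ ((Nat.log 2 n + max c₁ c₂) ^ max c₁ c₂) :=
            Nat.pow_le_pow_right (by norm_num) (CompressionFloors.polylog_mono (le_max_right _ _))
  obtain ⟨c, hc⟩ := exists_narrow_subst_of_isVQPFamily_general (ι := fun n => Fin n ⊕ Fin (D n + 1))
    Q hQ (k := fun _ => 1) (l := fun _ => 1) θ hθ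
  refine ⟨c, fun n hn => ?_⟩
  obtain ⟨e, hl, hv⟩ := hc n hn
  refine ⟨e, hl, fun ρ γ => ?_⟩
  rw [hv]
  -- the value identity
  set row : Fin n → MvPolynomial (Fin n × Fin n) ℂ := fun j => X (ρ 0, j) with hrow
  have hcore : ∀ d : ℕ, aeval (fun j : Fin n => aeval row (esymm (Fin n) ℂ (j.val + 1))) (P n d) =
      aeval row (coeffEps d (H n)) := by
    intro d
    rw [← hP n d, ← AlgHom.comp_apply, comp_aeval]
  have hθv : (fun i => (θ n i).value n ρ γ) =
      Sum.elim (fun j : Fin n => aeval row (esymm (Fin n) ℂ (j.val + 1)))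
        (fun d : Fin (D n + 1) => (X (ρ 0, γ 0) : MvPolynomial (Fin n × Fin n) ℂ) ^ d.val) := by
    funext i
    rcases i with j | d
    · show (E n (j.val + 1)).value n ρ γ = _
      rw [(hE n (j.val + 1) (by have := j.isLt; omega)).2]
      rfl
    · show (Epw d.val).value n ρ γ = _
      rw [hEpwv]
      rfl
  rw [hθv]
  show aeval _ (∑ d : Fin (D n + 1), X (Sum.inr d) * rename Sum.inl (P n d.val)) = _
  rw [map_sum]
  have hterm : ∀ d : Fin (D n + 1),
      aeval (Sum.elim (fun j : Fin n => aeval row (esymm (Fin n) ℂ (j.val + 1)))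
        (fun d : Fin (D n + 1) => (X (ρ 0, γ 0) : MvPolynomial (Fin n × Fin n) ℂ) ^ d.val))
        (X (Sum.inr d) * rename Sum.inl (P n d.val)) =
      (X (ρ 0, γ 0) : MvPolynomial (Fin n × Fin n) ℂ) ^ d.val * aeval row (coeffEps d.val (H n)) := by
    intro d
    rw [map_mul, aeval_X, aeval_rename, Sum.elim_inr]
    congr 1
    rw [← hcore d.val]
    rfl
  simp_rw [hterm]
  conv_rhs => rw [CoefficientSlices.eq_sum_X_pow_mul_rename_coeffEps (H n) (hDt n)]
  rw [map_sum, Finset.sum_range (fun d => aeval _ (X none ^ d * rename some (coeffEps d (H n))))]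
  refine Finset.sum_congr rfl fun d _ => ?_
  rw [map_mul, map_pow, aeval_X, aeval_rename]
  rfl

/-- The `VP` case of the pinned-entry row gadget. [cite: BlaserJindal2019, Thm. 4] -/
theorem exists_pinnedEntryRowGadget_of_VP (H : (n : ℕ) → MvPolynomial (Option (Fin n)) ℂ)
    (hsymm : ∀ (n : ℕ) (τ : Equiv.Perm (Fin n)), rename (Option.map τ) (H n) = H n)
    (hH : IsVPFamily H) :
    ∃ c : ℕ, ∀ n : ℕ, 1 ≤ n → ∃ W : PatternExpr ℂ 1 1,
      W.length ≤ 2 ^ ((Nat.log 2 n + c) ^ c) ∧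
      ∀ (ρ γ : Fin 1 → Fin n), W.value n ρ γ =
        aeval (fun o : Option (Fin n) => o.elim (X (ρ 0, γ 0))
          (fun j => (X (ρ 0, j) : MvPolynomial (Fin n × Fin n) ℂ))) (H n) :=
  exists_pinnedEntryRowGadget H hsymm hH.isVQPFamily

/-! ### The 2-row stratum for inner polynomials affine in the second row -/

/-- ★ **The 2-row stratum for second-row-affine inner polynomials.**  For a `VQP` family
`H_n ∈ ℂ[t, r_0, …, r_{n-1}]` symmetric in `r`, the matrix-symmetric family
`f_n = Σ_i Σ_b (Σ_{i'} x_{i'b}) · H_n(x_{ib}; x_{i0}, …, x_{i,n-1}) = Σ_{i,i'} g_n(row i, row i')`,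
`g_n(r, s) = Σ_b s_b H_n(r_b; r)`, satisfies the conclusion of `stub_narrowExpressionCompression`
(with `(2,1)` labels). [cite: BlaserJindal2019, Thm. 4] -/
theorem narrowQP_twoRow_pinnedAffine (H : (n : ℕ) → MvPolynomial (Option (Fin n)) ℂ)
    (hsymm : ∀ (n : ℕ) (τ : Equiv.Perm (Fin n)), rename (Option.map τ) (H n) = H n)
    (hH : IsVQPFamily H) :
    ∃ c : ℕ, ∀ n : ℕ, 1 ≤ n → ∃ (k l : ℕ) (e : PatternExpr ℂ k l),
      n ^ (k + l) ≤ 2 ^ ((Nat.log 2 n + c) ^ c) ∧ e.length ≤ 2 ^ ((Nat.log 2 n + c) ^ c) ∧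
      e.close n = ∑ i : Fin n, ∑ b : Fin n, (∑ i' : Fin n, (X (i', b) : MvPolynomial (Fin n × Fin n) ℂ)) *
        aeval (fun o : Option (Fin n) => o.elim (X (i, b))
          (fun j => (X (i, j) : MvPolynomial (Fin n × Fin n) ℂ))) (H n) := by
  classical
  obtain ⟨c₁, hc₁⟩ := exists_pinnedEntryRowGadget H hsymm hH
  obtain ⟨c₂, hc₂⟩ := NarrowClosure.qp_combine c₁ 0
  refine ⟨max c₂ 4, fun n hn => ?_⟩
  obtain ⟨W, hWl, hWv⟩ := hc₁ n hn
  obtain ⟨W', hW'l, hW'v⟩ :=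
    NarrowClosure.exists_value_eq_pad (F := ℂ) (k := 1) (l := 1) (K := 2) (L := 1) (by norm_num) le_rfl n W
  set G : Fin n → Fin n → MvPolynomial (Fin n × Fin n) ℂ := fun i b =>
    aeval (fun o : Option (Fin n) => o.elim (X (i, b))
      (fun j => (X (i, j) : MvPolynomial (Fin n × Fin n) ℂ))) (H n) with hG
  have hW'G : ∀ (ρ : Fin 2 → Fin n) (γ : Fin 1 → Fin n), W'.value n ρ γ = G (ρ 0) (γ 0) := by
    intro ρ γ
    rw [hW'v, hWv]
    rfl
  -- e₁ = c_{γ0} · W', e₂ = Σ_b, e₃ = Σ_i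
  set e₁ : PatternExpr ℂ 2 1 :=
    PatternExpr.mul (PatternExpr.sumRow 1 (PatternExpr.edge 1 0)) W' with he₁
  set e₂ : PatternExpr ℂ 2 1 := PatternExpr.sumCol 0 e₁ with he₂
  set e₃ : PatternExpr ℂ 2 1 := PatternExpr.sumRow 0 e₂ with he₃
  have hv₁ : ∀ (ρ : Fin 2 → Fin n) (γ : Fin 1 → Fin n), e₁.value n ρ γ =
      (∑ i' : Fin n, (X (i', γ 0) : MvPolynomial (Fin n × Fin n) ℂ)) * G (ρ 0) (γ 0) := by
    intro ρ γ
    simp only [he₁, PatternExpr.value_mul, PatternExpr.value_sumRow, PatternExpr.value_edge,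
      Function.update_self, hW'G]
  have hv₂ : ∀ (ρ : Fin 2 → Fin n) (γ : Fin 1 → Fin n), e₂.value n ρ γ =
      ∑ b : Fin n, (∑ i' : Fin n, (X (i', b) : MvPolynomial (Fin n × Fin n) ℂ)) * G (ρ 0) b := by
    intro ρ γ
    simp only [he₂, PatternExpr.value_sumCol, hv₁, Function.update_self]
  have hv₃ : ∀ (ρ : Fin 2 → Fin n) (γ : Fin 1 → Fin n), e₃.value n ρ γ =
      ∑ i : Fin n, ∑ b : Fin n, (∑ i' : Fin n, (X (i', b) : MvPolynomial (Fin n × Fin n) ℂ)) * G i b := by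
    intro ρ γ
    simp only [he₃, PatternExpr.value_sumRow, hv₂]
    refine Finset.sum_congr rfl fun i _ => ?_
    have h0 : (1 : Fin 2) ≠ 0 := by decide
    simp [Function.update_self]
  obtain ⟨e₄, hl₄, hc₄⟩ := exists_close_eq_of_value_const_kl hn e₃ _ hv₃
  refine ⟨2, 1, e₄, ?_, ?_, by rw [hc₄]⟩
  · calc n ^ (2 + 1) ≤ n ^ 3 + 3 := by norm_num
      _ ≤ 2 ^ ((Nat.log 2 n + 4) ^ 4) := CompressionFloors.pbounded_le_qp n 3
      _ ≤ 2 ^ ((Nat.log 2 n + max c₂ 4) ^ max c₂ 4) :=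
          Nat.pow_le_pow_right (by norm_num) (CompressionFloors.polylog_mono (le_max_right _ _))
  · have h := hc₂ (Nat.log 2 n) W.length 2 hWl (by norm_num)
    calc e₄.length = W.length + 7 := by
          rw [hl₄, he₃, he₂, he₁]; simp [PatternExpr.length, hW'l]; ring
      _ ≤ (W.length + 2) * (2 + 2) := by omega
      _ ≤ 2 ^ ((Nat.log 2 n + c₂) ^ c₂) := h
      _ ≤ 2 ^ ((Nat.log 2 n + max c₂ 4) ^ max c₂ 4) :=
          Nat.pow_le_pow_right (by norm_num) (CompressionFloors.polylog_mono (le_max_left _ _))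

/-- The `VP` case of the second-row-affine 2-row stratum. [cite: BlaserJindal2019, Thm. 4] -/
theorem narrowQP_twoRow_pinnedAffine_of_VP (H : (n : ℕ) → MvPolynomial (Option (Fin n)) ℂ)
    (hsymm : ∀ (n : ℕ) (τ : Equiv.Perm (Fin n)), rename (Option.map τ) (H n) = H n)
    (hH : IsVPFamily H) :
    ∃ c : ℕ, ∀ n : ℕ, 1 ≤ n → ∃ (k l : ℕ) (e : PatternExpr ℂ k l),
      n ^ (k + l) ≤ 2 ^ ((Nat.log 2 n + c) ^ c) ∧ e.length ≤ 2 ^ ((Nat.log 2 n + c) ^ c) ∧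
      e.close n = ∑ i : Fin n, ∑ b : Fin n, (∑ i' : Fin n, (X (i', b) : MvPolynomial (Fin n × Fin n) ℂ)) *
        aeval (fun o : Option (Fin n) => o.elim (X (i, b))
          (fun j => (X (i, j) : MvPolynomial (Fin n × Fin n) ℂ))) (H n) :=
  narrowQP_twoRow_pinnedAffine H hsymm hH.isVQPFamily

end FormulaSubstitution

end Summit.ValiantsHypothesis.ValiantsHypothesis.Theorems

end
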